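import Literature.MathematicalPhysics.QuantumFieldTheory.Federbush1986.PureAveragesSU2Prop59
import Literature.MathematicalPhysics.QuantumFieldTheory.Federbush1986.PureAveragesSU2Lemma11

/-!
# `Federbush1986.PureAveragesSU2Existence` — P. Federbush, *A phase cell approach to Yang–Mills theory. III. Local stability,
# modified renormalization group transformation*, Commun. Math. Phys. **110** (1987) 293–309 [Federbush1987PhaseCellIII], §1
# (1.1)–(1.2): «we define an average ḡ … as THE element minimizing Σ_i d²(ḡ, g_i)» — EXISTENCE (compactness of `SU(2)`) and
# UNIQUENESS (for families of diameter `< π/4`) of the pure average, PROVED for the model instance `G = SU(2)`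

statement-level skeleton of published theorems with citation tags; proofs where landed; nothing here is a claim about the Yang–Mills mass gap

PDF held: `fed1987-cmp110-III` (scan `run/shared/lean/pub/pub-balaban/t4/b2b-balaban-t4-lit2/pdf/fed1987-cmp110-III.pdf`, render
`run/shared/lean/pub/lit-balaban/lit-balaban-r17/renders/fedIII/fed1987-cmp110-III-p003-x2.png` (p. 295); journal page = PDF page + 292).

CITATION HEADER (lean-in-tree rule).  lit-balaban cell (HOME `run/shared/lean/pub/lit-balaban/`), SKELETON row **F3.Eq1.1-1.2** (reader
r17; `…Federbush1986.PureAverages.IsPureAverage`, p238910: the PREDICATE «ḡ minimises (1.2)»; its docstring: «print presupposes a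
unique minimiser for elements close together — not asserted»); Phase-2 seat p32 (gen 3), unit `lit-balaban-p32-g3`, kind
«model-instance» over `…PureAveragesSU2` (carrier), `…PureAveragesSU2Lemma13` (uniqueness half of Lemma 1.3,
`SU2.isPureAverage_unique`) and `…PureAveragesSU2Prop59` (a-priori localisation `SU2.dist_lt_two_mul_of_isPureAverage`).
WHAT IS HERE, for `G = SU(2)` (unit quaternions, great-circle bi-invariant distance): the identification with the round sphere is
bi-Lipschitz (`norm_sub_le_dist`, `dist_le_pi_div_two_mul_norm_sub`: `|p − q| ≤ d(p, q) ≤ (π/2)|p − q|`), hence `SU2` is COMPACT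
(`SU2.compactSpace`, a theorem — use `haveI := SU2.compactSpace`); (1.2) always HAS a minimiser (`exists_isPureAverage`); and for `n ≥ 1` elements with all
`d(g_i, g_j) < π/4` the minimiser is UNIQUE (`existsUnique_isPureAverage`) — so «the element minimizing (1.2)» (1.1) is well
defined there, which is the well-definedness of Bałaban's operation `M` [Balaban1987RG1] (0.10) for `SU(2)` under Federbush's
definition; the PACKAGE print works with (p. 294–295; [Balaban1987RG1] (0.8), (0.10)): for `n ≥ 1` and `|A_i| < 1/10` the pure
average of `{e^{A_i}}` is `e^x` for a unique point, with `|x| < 1/2` and `Σ_i log(e^{−x}e^{A_i}) = 0` (`pureAverage_package`), so that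
Lemmas 1.2/1.3 (`SU2.lemma12_SU2`, `SU2.lemma13_SU2`, radii `1/2`, `π/2`; all of §1 for `SU(2)` is in the imports, incl. `SU2.lemma11_SU2`) apply to it; and, in the ABSTRACT setting of the statement
file, the averaged form of Lemma 1.2 = (0.8) «(1/i) log M({exp iA_j}) = (1/n)ΣA_j + (higher order terms)»:
`|x − (1/n)ΣA_i| ≤ c|x|³ + (c/n)Σ|A_i|³` for any data satisfying `Lemma12` (`norm_sub_mean_le_of_lemma12`).  The thresholds `π/4`,
`1/10` are this file's (print: «sufficiently close to the identity»).
-/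

namespace Literature.MathematicalPhysics.QuantumFieldTheory.Federbush1986

open scoped Quaternion RealInnerProductSpace
open InnerProductGeometry

noncomputable section

namespace SU2

open Real

/-- The parametrisation of `SU2` by the unit sphere of `ℍ`. [cite: Federbush1987PhaseCellIII, §1 p. 294] -/
theorem continuous_ofSphere :
    Continuous (fun x : Metric.sphere (0 : ℍ) 1 => (⟨x.1, mem_sphere_zero_iff_norm.mp x.2⟩ : SU2)) := by
  rw [Metric.continuous_iff]
  intro b ε hε
  refine ⟨2 / π * ε, by positivity, fun a ha => ?_⟩
  calc dist (⟨a.1, _⟩ : SU2) ⟨b.1, _⟩ ≤ π / 2 * ‖a.1 - b.1‖ := dist_le_pi_div_two_mul_norm_sub _ _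
    _ = π / 2 * dist a b := by rw [Subtype.dist_eq, dist_eq_norm]
    _ < π / 2 * (2 / π * ε) := by gcongr
    _ = ε := by field_simp

/-- **`SU(2)` is compact** (for the great-circle distance; «G a compact Lie Group», p. 294). [cite: Federbush1987PhaseCellIII, §1 p. 294] -/
theorem compactSpace : CompactSpace SU2 := by
  have hc : CompactSpace (Metric.sphere (0 : ℍ) 1) := isCompact_iff_compactSpace.mp (isCompact_sphere 0 1)
  have hsurj : Function.Surjective (fun x : Metric.sphere (0 : ℍ) 1 => (⟨x.1, mem_sphere_zero_iff_norm.mp x.2⟩ : SU2)) := by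
    intro p
    exact ⟨⟨p.val, mem_sphere_zero_iff_norm.mpr p.norm_val⟩, rfl⟩
  exact ⟨by rw [← hsurj.range_eq]; exact isCompact_range continuous_ofSphere⟩

/-- (1.2) is continuous in the candidate `ḡ`. [cite: Federbush1987PhaseCellIII, §1 (1.2) p. 295] -/
theorem continuous_sumSqDist {n : ℕ} (gs : Fin n → SU2) : Continuous (sumSqDist gs) := by
  unfold sumSqDist
  fun_prop

/-- **Existence of the pure average on `SU(2)`**: (1.2) attains its minimum — «we define an average ḡ … as the element minimizing
(1.2)» is never vacuous for `G = SU(2)`. [cite: Federbush1987PhaseCellIII, §1 (1.1)–(1.2) p. 294–295] -/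
theorem exists_isPureAverage {n : ℕ} (gs : Fin n → SU2) : ∃ gbar : SU2, IsPureAverage gs gbar := by
  haveI := compactSpace
  obtain ⟨g, -, hg⟩ := isCompact_univ.exists_isMinOn (Set.univ_nonempty) (continuous_sumSqDist gs).continuousOn
  exact ⟨g, fun h => hg (Set.mem_univ h)⟩

/-- **Existence and uniqueness of the pure average on `SU(2)`** for `n ≥ 1` elements with all `d(g_i, g_j) < π/4`: «THE element
minimizing (1.2)» (1.1) is well defined — the well-definedness of Bałaban's `M` [Balaban1987RG1] (0.10) on `SU(2)` under Federbush's
definition.  (Existence: compactness; uniqueness: a-priori localisation `dist_lt_two_mul_of_isPureAverage` + Lemma 1.3's uniqueness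
half `isPureAverage_unique`.) [cite: Federbush1987PhaseCellIII, §1 (1.1)–(1.2) p. 294–295] -/
theorem existsUnique_isPureAverage {n : ℕ} (hn : 0 < n) (gs : Fin n → SU2) (hclose : ∀ i j, dist (gs i) (gs j) < π / 4) :
    ∃! gbar : SU2, IsPureAverage gs gbar := by
  obtain ⟨gbar, hbar⟩ := exists_isPureAverage gs
  have hloc : ∀ i, dist gbar (gs i) < π / 2 := fun i => by
    have := dist_lt_two_mul_of_isPureAverage gs gbar hbar hclose i; linarith
  exact ⟨gbar, hbar, fun h hh => isPureAverage_unique hn gs gbar hloc hbar hh⟩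

/-- **The package print works with**, for `SU(2)`: for `n ≥ 1` Lie-algebra elements with `|A_i| < 1/10`, the pure average (1.1)–(1.2) of
`{e^{A_i}}` is `e^x` for a UNIQUE group element, `|x| < 1/2` («ḡ = e^x», «|x| small»), and Bałaban's equation (0.10)
`Σ_i log(e^{−x}e^{A_i}) = 0` holds; Lemmas 1.2 and 1.3 for `SU(2)` (`lemma12_SU2`, `lemma13_SU2`) then apply to this `x`.
[cite: Federbush1987PhaseCellIII, §1 (1.1)–(1.2), Lemma 1.3 p. 294–296] -/
theorem pureAverage_package {n : ℕ} (hn : 0 < n) (A : Fin n → su2) (hA : ∀ i, ‖A i‖ < 1 / 10) :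
    ∃ x : su2, ‖x‖ < 1 / 2 ∧ IsPureAverage (fun i => expSU2 (A i)) (expSU2 x) ∧
      (∀ h : SU2, IsPureAverage (fun i => expSU2 (A i)) h → h = expSU2 x) ∧
      ∑ i, logSU2 ((expSU2 x)⁻¹ * expSU2 (A i)) = 0 := by
  have hπ3 : (3 : ℝ) < π := Real.pi_gt_three
  have hclose : ∀ i j, dist (expSU2 (A i)) (expSU2 (A j)) < 1 / 5 := fun i j => by
    have := dist_expSU2_expSU2_le (A i) (A j) (by linarith [hA i]) (by linarith [hA j])
    linarith [hA i, hA j]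
  have hclose' : ∀ i j, dist (expSU2 (A i)) (expSU2 (A j)) < π / 4 := fun i j => by linarith [hclose i j]
  obtain ⟨gbar, hbar, huniq⟩ := existsUnique_isPureAverage hn (fun i => expSU2 (A i)) hclose'
  have hloc : ∀ i, dist gbar (expSU2 (A i)) < 2 * (1 / 5) := fun i =>
    dist_lt_two_mul_of_isPureAverage (fun i => expSU2 (A i)) gbar hbar hclose i
  have hdist : dist 1 gbar < 1 / 2 := by
    let i₀ : Fin n := ⟨0, hn⟩
    calc dist 1 gbar ≤ dist 1 (expSU2 (A i₀)) + dist (expSU2 (A i₀)) gbar := dist_triangle _ _ _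
      _ < 1 / 10 + 2 * (1 / 5) := by
          rw [dist_one_expSU2 (A i₀) (by linarith [hA i₀]), dist_comm]
          exact add_lt_add (hA i₀) (hloc i₀)
      _ = 1 / 2 := by norm_num
  have hπ : dist 1 gbar < π := by linarith
  refine ⟨logSU2 gbar, ?_, ?_, ?_, ?_⟩
  · rw [norm_logSU2 gbar hπ]; exact hdist
  · rw [expSU2_logSU2 gbar hπ]; exact hbar
  · intro h hh; rw [expSU2_logSU2 gbar hπ]; exact huniq h hh
  · rw [expSU2_logSU2 gbar hπ]
    exact (isPureAverage_iff_sum_logSU2_eq_zero (fun i => expSU2 (A i)) gbar (fun i => by linarith [hloc i])).mp hbar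

/-- **Federbush III §1 + Prop. 5.9 for `SU(2)` in one line**: the typed rows F3.Lem1.0 (normalisation radius `π`), F3.Lem1.1,
F3.Lem1.2, F3.Lem1.3 and F3.Prop5.9 of the cell's statement file all hold for the model instance `G = SU(2)`, `𝔤 = 𝔰𝔲(2)`,
`exp = expSU2`. [cite: Federbush1987PhaseCellIII, §1 Lemmas 1.0–1.3 p. 294–296, §5.2 Prop. 5.9 p. 304] -/
theorem federbushIII_section1_SU2 :
    Lemma10Normalisation expSU2 Real.pi ∧ Lemma11 expSU2 ∧ Lemma12 expSU2 ∧ Lemma13 expSU2 ∧ Proposition59 SU2 :=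
  ⟨lemma10_SU2, lemma11_SU2, lemma12_SU2, lemma13_SU2, proposition59_SU2⟩

end SU2

/-! ## (0.8): the averaged form of Lemma 1.2, in the abstract setting of the statement file -/

section Abstract

variable {G : Type*} [Group G] [MetricSpace G]
variable {𝔤 : Type*} [NormedAddCommGroup 𝔤] [NormedSpace ℝ 𝔤]

omit [Group G] in
/-- **(0.8) from Lemma 1.2**, for ANY data `(G, d, 𝔤, exp)` satisfying the typed Lemma 1.2 (`Lemma12 exp`): with the same `ρ`, `c`,
a pure average `e^x` of `{e^{A_i}}` (`n ≥ 1`, all small) satisfies `|x − (1/n)ΣA_i| ≤ c|x|³ + (c/n)Σ_i|A_i|³` — [Balaban1987RG1]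
(0.8) «(1/i) log M({exp iA_j}) = (1/n) Σ_j A_j + (higher order terms)» for Federbush's average; for `G = SU(2)` feed
`SU2.lemma12_SU2`. [cite: Federbush1987PhaseCellIII, Lemma 1.2 (1.10) p. 295] -/
theorem norm_sub_mean_le_of_lemma12 {exp : 𝔤 → G} (h12 : Lemma12 exp) :
    ∃ ρ > (0 : ℝ), ∃ c : ℝ, ∀ (n : ℕ), 0 < n → ∀ (A : Fin n → 𝔤) (x : 𝔤),
      (∀ i, ‖A i‖ < ρ) → ‖x‖ < ρ → IsPureAverage (fun i => exp (A i)) (exp x) →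
        ‖x - (n : ℝ)⁻¹ • ∑ i, A i‖ ≤ c * ‖x‖ ^ 3 + c * (n : ℝ)⁻¹ * ∑ i, ‖A i‖ ^ 3 := by
  obtain ⟨ρ, hρ, c, hmain⟩ := h12
  refine ⟨ρ, hρ, c, fun n hn A x hA hx hmin => ?_⟩
  obtain ⟨T, hxT, hT⟩ := hmain n hn A x hA hx hmin
  have hn' : (0 : ℝ) < n := by exact_mod_cast hn
  have hx' : x - (n : ℝ)⁻¹ • ∑ i, A i = (n : ℝ)⁻¹ • ∑ i, T i := by
    rw [hxT]; abel
  rw [hx', norm_smul, Real.norm_eq_abs, abs_of_pos (inv_pos.mpr hn')]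
  calc (n : ℝ)⁻¹ * ‖∑ i, T i‖ ≤ (n : ℝ)⁻¹ * ∑ i, ‖T i‖ :=
        mul_le_mul_of_nonneg_left (norm_sum_le _ _) (inv_pos.mpr hn').le
    _ ≤ (n : ℝ)⁻¹ * ∑ i, c * (‖x‖ ^ 3 + ‖A i‖ ^ 3) :=
        mul_le_mul_of_nonneg_left (Finset.sum_le_sum fun i _ => hT i) (inv_pos.mpr hn').le
    _ = c * ‖x‖ ^ 3 + c * (n : ℝ)⁻¹ * ∑ i, ‖A i‖ ^ 3 := by
        simp only [mul_add]
        rw [Finset.sum_add_distrib, Finset.sum_const, Finset.card_univ, Fintype.card_fin, nsmul_eq_mul, ← Finset.mul_sum]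
        field_simp

omit [NormedAddCommGroup 𝔤] [NormedSpace ℝ 𝔤] in
/-- **Existence of the pure average in ANY compact group with a (continuous) distance** — the abstract form of «G a compact Lie
Group … we define an average ḡ … as the element minimizing (1.2)»: (1.2) is continuous and `G` is compact and nonempty (`ε ∈ G`),
so a minimiser exists. [cite: Federbush1987PhaseCellIII, §1 (1.1)–(1.2) p. 294–295] -/
theorem exists_isPureAverage_of_compactSpace [CompactSpace G] {n : ℕ} (gs : Fin n → G) : ∃ gbar : G, IsPureAverage gs gbar := by
  have hc : Continuous (sumSqDist gs) := by unfold sumSqDist; fun_prop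
  obtain ⟨g, -, hg⟩ := isCompact_univ.exists_isMinOn ⟨(1 : G), Set.mem_univ _⟩ hc.continuousOn
  exact ⟨g, fun h => hg (Set.mem_univ h)⟩

end Abstract



end

end Literature.MathematicalPhysics.QuantumFieldTheory.Federbush1986
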